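import Summits.QuantumFields.BalabanUV.T4Continuum.Support.NE7EJBracketIntegral

/-!
# NE7EJBracketRemainders — row NE7 (node U5), candidate route HOM, variant H1L-EJ: (E1) ON SUBINTERVALS, THE REMAINDERS `R₂`, `R₂′` AS
# INTEGRALS OF THE DEFECT DROP, AND THE CHORD INEQUALITY — ABSTRACT, REAL SLICE, EVERY MINIMISER SELECTION

Lineage `b2b-balaban-t4-ne7-p2` (CRUX PROVER NE7 #2 = C-HOM°'s kernel hand), generation 80; file 112 (sequel of 106 `NE7EJBracket`, 107
`NE7EJBracketIntegral`).  CONSUMER SHAPES (by name): lens 2's S-91-1 (`t4/ideate/NE7/lens2-g91/ENVELOPE-SUPPLY.md` §2: «Taylor with integral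
remainder at τ = 0 and τ = 1: (E4a) R₂ = 𝔇(U^A) − Br = g′(0) − (g(1) − g(0)) … (E4b) R₂′ = Br − 𝔇(U^B) … (E4c) R₂ + R₂′ = 𝔇(U^A) − 𝔇(U^B)») and
lens 1's (E1)∕(E3) (`lens1-g58/DEFECT-NOTE.md` §2: «the bracket is the AVERAGE of the defect along the path»).  In file 106's abstract setting
(ANY two functionals, ANY fibre, ANY minimiser selection on `[0,1]`; no differentiability, no uniqueness):
* §1 reparametrisation: `lineF_reparam` (the line between `A_a` and `A_b` is the line `A_c + τ𝔇` run at `τ = a + t(b−a)`), `defect_reparam`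
  (its defect is `(b−a)·𝔇`), `lineVal_reparam`.
* §2 **(E1) ON EVERY SUBINTERVAL**: `lineVal_sub_eq_integral` — `g(b) − g(a) = ∫_a^b 𝔇(U_τ) dτ` for `0 ≤ a ≤ b ≤ 1` (file 107 applied to the
  reparametrised pair, then `intervalIntegral.smul_integral_comp_mul_add`).
* §3 **THE REMAINDERS AS INTEGRALS OF THE DEFECT DROP** (lens 2's (E4a)∕(E4b) at first order — the weights `(1−τ)q`, `τq` integrate to these
  by parts; here WITHOUT `q`, i.e. without any Hessian): **`remB_eq_integral`** (`R₂ = ∫₀¹ (𝔇(U_0) − 𝔇(U_τ)) dτ`), **`remA_eq_integral`**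
  (`R₂′ = ∫₀¹ (𝔇(U_τ) − 𝔇(U_1)) dτ`), with NON-NEGATIVE, MONOTONE integrands (`remB_integrand_nonneg ∕ _monotoneOn`, `remA_integrand_nonneg ∕
  _antitoneOn`) — so `R₂` is small exactly when the defect at the line's minimiser stays close to its initial value (lens 1's (T2) mechanism,
  abstractly).
* §4 **THE CHORD INEQUALITY** ((E3) read at the endpoints): `lineVal_ge_chord` — `(1−τ)·g(0) + τ·g(1) ≤ g(τ)`: along HOM's line the minimum
  value lies ABOVE the chord between run A's and run B's minimum values; `lineVal_ge_min_endpoints`.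

HONEST FRAMING: [folklore]; REAL SLICE ONLY (minimisers); nothing of Bałaban's instantiated; NOT (N1) ∕ (N1′) ∕ EJ-1c ∕ EJ-2 ∕ EJ-3 ∕ K1-var(s);
NOT a letter move; credit (E1)–(E3) lens 1 g58, (E4a∕b) lens 2 g91.  NE7 NOT PRINTED ∕ NOT PROVED; spine 0∕9; FIXED FINITE T⁴, rung (B)+1; NOT
infinite volume, NOT mass gap, NOT Clay.  HONEST DEPENDENCY: continuum YM on T⁴ ⇐ BetaPertH ∧ nine spine estimates (0/9 proved); BetaPertH ⇐
(D1) ∧ (D4) ∧ CAP+tail; G-an2-4 gates asym, D1 and NE2/3/4.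
-/

noncomputable section

open Set MeasureTheory intervalIntegral

namespace Summit.QuantumFields.BalabanUV.T4Continuum.NE7EJBracketRemainders

open NE7EJBracket NE7EJBracketIntegral

variable {X : Type*}

/-! ### §1 Reparametrisation of the line between two of its points -/

section Reparam

variable (Ac AB : X → ℝ)

/-- the line between `A_a` and `A_b` is the original line reparametrised: `lineF A_a A_b t = A_{a + t(b−a)}`. [folklore] -/
theorem lineF_reparam (a b t : ℝ) : lineF (lineF Ac AB a) (lineF Ac AB b) t = lineF Ac AB (a + t * (b - a)) := by
  funext u
  simp only [lineF_apply]
  ring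

/-- its defect is `(b − a)·𝔇`. [folklore] -/
theorem defect_reparam (a b : ℝ) (u : X) : defect (lineF Ac AB a) (lineF Ac AB b) u = (b - a) * defect Ac AB u := by
  simp only [defect_apply, lineF_apply]
  ring

/-- its value along the reparametrised selection `t ↦ u(a + t(b−a))` is `g(a + t(b−a))`. [folklore] -/
theorem lineVal_reparam (u : ℝ → X) (a b t : ℝ) :
    lineVal (lineF Ac AB a) (lineF Ac AB b) (fun t => u (a + t * (b - a))) t = lineVal Ac AB u (a + t * (b - a)) := by
  rw [lineVal_apply, lineVal_apply, lineF_reparam]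

end Reparam

/-! ### §2 (E1) on every subinterval of `[0,1]` -/

section Subinterval

variable {Ac AB : X → ℝ} {S : Set X} {u : ℝ → X}

/-- the reparametrised parameter stays in `[0,1]`. [folklore] -/
theorem reparam_mem_Icc {a b : ℝ} (ha : 0 ≤ a) (hab : a ≤ b) (hb : b ≤ 1) {t : ℝ} (ht : t ∈ Icc (0:ℝ) 1) :
    a + t * (b - a) ∈ Icc (0:ℝ) 1 := by
  obtain ⟨ht0, ht1⟩ := ht
  constructor
  · nlinarith
  · nlinarith

/-- **(E1) ON A SUBINTERVAL**: for a minimiser selection on `[0,1]` and `0 ≤ a ≤ b ≤ 1`, `g(b) − g(a) = ∫_a^b 𝔇(u τ) dτ`. [folklore] -/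
theorem lineVal_sub_eq_integral (hmem : ∀ τ ∈ Icc (0:ℝ) 1, u τ ∈ S) (hmin : ∀ τ ∈ Icc (0:ℝ) 1, IsMinOn (lineF Ac AB τ) S (u τ))
    {a b : ℝ} (ha : 0 ≤ a) (hab : a ≤ b) (hb : b ≤ 1) :
    lineVal Ac AB u b - lineVal Ac AB u a = ∫ τ in a..b, defect Ac AB (u τ) := by
  -- the reparametrised selection is a minimiser selection for the pair (A_a, A_b)
  set v : ℝ → X := fun t => u (a + t * (b - a)) with hv
  have hmem' : ∀ t ∈ Icc (0:ℝ) 1, v t ∈ S := fun t ht => hmem _ (reparam_mem_Icc ha hab hb ht)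
  have hmin' : ∀ t ∈ Icc (0:ℝ) 1, IsMinOn (lineF (lineF Ac AB a) (lineF Ac AB b) t) S (v t) := fun t ht => by
    rw [lineF_reparam]
    exact hmin _ (reparam_mem_Icc ha hab hb ht)
  have h := lineVal_one_sub_zero_eq_integral hmem' hmin'
  rw [hv, lineVal_reparam, lineVal_reparam] at h
  simp only [one_mul, zero_mul, add_zero, add_sub_cancel, defect_reparam] at h
  rw [h, intervalIntegral.integral_const_mul]
  -- change of variables τ = (b − a)·t + a
  have hcv := intervalIntegral.smul_integral_comp_mul_add (a := (0:ℝ)) (b := 1) (fun τ => defect Ac AB (u τ)) (b - a) a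
  simp only [mul_zero, zero_add, mul_one, sub_add_cancel, smul_eq_mul] at hcv
  rw [← hcv]
  congr 1
  refine intervalIntegral.integral_congr fun t _ => ?_
  simp only [show ∀ t : ℝ, (b - a) * t + a = a + t * (b - a) from fun t => by ring]

end Subinterval

/-! ### §3 The remainders as integrals of the defect drop -/

section Remainders

variable {Ac AB : X → ℝ} {S : Set X} {u : ℝ → X}

/-- the defect along a minimiser selection on `[0,1]` is interval-integrable (antitone). [folklore] -/
theorem defect_intervalIntegrable (hmem : ∀ τ ∈ Icc (0:ℝ) 1, u τ ∈ S)
    (hmin : ∀ τ ∈ Icc (0:ℝ) 1, IsMinOn (lineF Ac AB τ) S (u τ)) :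
    IntervalIntegrable (fun τ => defect Ac AB (u τ)) volume 0 1 := by
  have hf : AntitoneOn (fun τ => defect Ac AB (u τ)) (uIcc (0:ℝ) 1) := by
    rw [Set.uIcc_of_le zero_le_one]; exact defect_antitoneOn hmem hmin
  exact hf.intervalIntegrable

/-- **`R₂ = ∫₀¹ (𝔇(U_0) − 𝔇(U_τ)) dτ`** — run B's action excess at run A's minimiser is the integrated DROP of the defect along the line
(lens 2's (E4a) without the Hessian weight). [folklore] -/
theorem remB_eq_integral (hmem : ∀ τ ∈ Icc (0:ℝ) 1, u τ ∈ S) (hmin : ∀ τ ∈ Icc (0:ℝ) 1, IsMinOn (lineF Ac AB τ) S (u τ)) :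
    remB AB (u 0) (u 1) = ∫ τ in (0:ℝ)..1, (defect Ac AB (u 0) - defect Ac AB (u τ)) := by
  have hBr := bracket_eq_integral (Ac := Ac) (AB := AB) hmem hmin
  rw [bracket_eq_defect_sub_remB] at hBr
  rw [intervalIntegral.integral_sub intervalIntegrable_const (defect_intervalIntegrable hmem hmin), intervalIntegral.integral_const,
    sub_zero, one_smul]
  linarith

/-- **`R₂′ = ∫₀¹ (𝔇(U_τ) − 𝔇(U_1)) dτ`** (lens 2's (E4b) without the Hessian weight). [folklore] -/
theorem remA_eq_integral (hmem : ∀ τ ∈ Icc (0:ℝ) 1, u τ ∈ S) (hmin : ∀ τ ∈ Icc (0:ℝ) 1, IsMinOn (lineF Ac AB τ) S (u τ)) :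
    remA Ac (u 0) (u 1) = ∫ τ in (0:ℝ)..1, (defect Ac AB (u τ) - defect Ac AB (u 1)) := by
  have hBr := bracket_eq_integral (Ac := Ac) (AB := AB) hmem hmin
  rw [bracket_eq_defect_add_remA] at hBr
  rw [intervalIntegral.integral_sub (defect_intervalIntegrable hmem hmin) intervalIntegrable_const, intervalIntegral.integral_const,
    sub_zero, one_smul]
  linarith

/-- the `R₂`-integrand is non-negative on `[0,1]`. [folklore] -/
theorem remB_integrand_nonneg (hmem : ∀ τ ∈ Icc (0:ℝ) 1, u τ ∈ S) (hmin : ∀ τ ∈ Icc (0:ℝ) 1, IsMinOn (lineF Ac AB τ) S (u τ))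
    {τ : ℝ} (hτ : τ ∈ Icc (0:ℝ) 1) : 0 ≤ defect Ac AB (u 0) - defect Ac AB (u τ) :=
  sub_nonneg.mpr (defect_antitoneOn hmem hmin ⟨le_refl _, zero_le_one⟩ hτ hτ.1)

/-- and non-decreasing. [folklore] -/
theorem remB_integrand_monotoneOn (hmem : ∀ τ ∈ Icc (0:ℝ) 1, u τ ∈ S) (hmin : ∀ τ ∈ Icc (0:ℝ) 1, IsMinOn (lineF Ac AB τ) S (u τ)) :
    MonotoneOn (fun τ => defect Ac AB (u 0) - defect Ac AB (u τ)) (Icc (0:ℝ) 1) := fun _ hσ _ hτ hστ =>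
  sub_le_sub_left (defect_antitoneOn hmem hmin hσ hτ hστ) _

/-- the `R₂′`-integrand is non-negative on `[0,1]`. [folklore] -/
theorem remA_integrand_nonneg (hmem : ∀ τ ∈ Icc (0:ℝ) 1, u τ ∈ S) (hmin : ∀ τ ∈ Icc (0:ℝ) 1, IsMinOn (lineF Ac AB τ) S (u τ))
    {τ : ℝ} (hτ : τ ∈ Icc (0:ℝ) 1) : 0 ≤ defect Ac AB (u τ) - defect Ac AB (u 1) :=
  sub_nonneg.mpr (defect_antitoneOn hmem hmin hτ ⟨zero_le_one, le_refl _⟩ hτ.2)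

/-- and non-increasing. [folklore] -/
theorem remA_integrand_antitoneOn (hmem : ∀ τ ∈ Icc (0:ℝ) 1, u τ ∈ S) (hmin : ∀ τ ∈ Icc (0:ℝ) 1, IsMinOn (lineF Ac AB τ) S (u τ)) :
    AntitoneOn (fun τ => defect Ac AB (u τ) - defect Ac AB (u 1)) (Icc (0:ℝ) 1) := fun _ hσ _ hτ hστ =>
  sub_le_sub_right (defect_antitoneOn hmem hmin hσ hτ hστ) _

/-- `R₂ ≤ 𝔇(U_0) − 𝔇(U_1)` and `R₂′ ≤ 𝔇(U_0) − 𝔇(U_1)` (each remainder is at most the total defect drop; (E4c) `R₂ + R₂′ =` the drop).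
[folklore] -/
theorem remB_le_drop (hmem : ∀ τ ∈ Icc (0:ℝ) 1, u τ ∈ S) (hmin : ∀ τ ∈ Icc (0:ℝ) 1, IsMinOn (lineF Ac AB τ) S (u τ)) :
    remB AB (u 0) (u 1) ≤ defect Ac AB (u 0) - defect Ac AB (u 1) ∧
      remA Ac (u 0) (u 1) ≤ defect Ac AB (u 0) - defect Ac AB (u 1) := by
  have h0 : (0:ℝ) ∈ Icc (0:ℝ) 1 := ⟨le_refl _, zero_le_one⟩
  have h1 : (1:ℝ) ∈ Icc (0:ℝ) 1 := ⟨zero_le_one, le_refl _⟩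
  have hA0 : IsMinOn Ac S (u 0) := by simpa [lineF_zero] using hmin 0 h0
  have hB1 : IsMinOn AB S (u 1) := by simpa [lineF_one] using hmin 1 h1
  have hsum := remB_add_remA Ac AB (u 0) (u 1)
  have hB := remB_nonneg (AB := AB) hB1 (hmem 0 h0)
  have hA := remA_nonneg (Ac := Ac) hA0 (hmem 1 h1)
  constructor <;> linarith

end Remainders

/-! ### §4 The chord inequality -/

section Chord

variable {Ac AB : X → ℝ} {S : Set X} {D : Set ℝ} {u : ℝ → X}

/-- **THE CHORD INEQUALITY**: for a minimiser selection on a convex parameter set containing `0` and `1` and `τ ∈ [0,1]`,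
`(1−τ)·g(0) + τ·g(1) ≤ g(τ)` — along HOM's line the minimum value lies ABOVE the chord between run A's and run B's minima. [folklore] -/
theorem lineVal_ge_chord (hD : Convex ℝ D) (hmem : ∀ τ ∈ D, u τ ∈ S) (hmin : ∀ τ ∈ D, IsMinOn (lineF Ac AB τ) S (u τ)) (h0 : (0:ℝ) ∈ D)
    (h1 : (1:ℝ) ∈ D) {τ : ℝ} (hτ : τ ∈ Icc (0:ℝ) 1) :
    (1 - τ) * lineVal Ac AB u 0 + τ * lineVal Ac AB u 1 ≤ lineVal Ac AB u τ := by
  have h := (concaveOn_lineVal hD hmem hmin).2 h0 h1 (sub_nonneg.mpr hτ.2) hτ.1 (by ring)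
  simp only [smul_eq_mul, mul_zero, mul_one, zero_add] at h
  exact h

/-- hence `min(g(0), g(1)) ≤ g(τ)`: the minimum value along the line never drops below the smaller endpoint. [folklore] -/
theorem lineVal_ge_min_endpoints (hD : Convex ℝ D) (hmem : ∀ τ ∈ D, u τ ∈ S) (hmin : ∀ τ ∈ D, IsMinOn (lineF Ac AB τ) S (u τ))
    (h0 : (0:ℝ) ∈ D) (h1 : (1:ℝ) ∈ D) {τ : ℝ} (hτ : τ ∈ Icc (0:ℝ) 1) :
    min (lineVal Ac AB u 0) (lineVal Ac AB u 1) ≤ lineVal Ac AB u τ := by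
  have h := lineVal_ge_chord hD hmem hmin h0 h1 hτ
  have hm0 := min_le_left (lineVal Ac AB u 0) (lineVal Ac AB u 1)
  have hm1 := min_le_right (lineVal Ac AB u 0) (lineVal Ac AB u 1)
  nlinarith [hτ.1, hτ.2]

end Chord

end Summit.QuantumFields.BalabanUV.T4Continuum.NE7EJBracketRemainders

end
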